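import Summits.QuantumFields.BalabanUV.T4Continuum.Spine.NE7.QLaAbelianBlockContraction
import Literature.MathematicalPhysics.QuantumFieldTheory.Balaban1983to89.BlockAveragingExpMeanLog
import Literature.MathematicalPhysics.QuantumFieldTheory.Balaban1983to89.B7Prop1Explicit

/-!
# Spine/NE7/QLaBlockAvgFramedStep — FRAMED DESCENT FROM THE FLAT CONFIGURATION (any gauge group), and the second-order
# matrix toolkit for the PRINTED (0.4) prescription `blockAvg expMeanLogSU` on `SU(N)`

Cell `pub-balaban-gaps` (YM blitz Y1, track G2, seat `ne7`, generation 8); text of record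
`run/shared/lean/pub/pub-balaban-gaps/ne/NE7.md` v8 §4nonies, census rows R52–R54.  Twenty-fifth `Spine/NE7/` file; first of the
four files `QLaBlockAvgFramedStep` ∕ `QLaBlockAvgEML` ∕ `QLaBlockAvgLinear` ∕ `QLaBlockAvgContraction` of generation 8.

WHY.  The HEADLINE of the T⁴ programme, `T4ContinuumYM4Torus.continuumYM4_torus_of_BetaPertH`, is stated for data
`D : FiniteEpsData F (Matrix.specialUnitaryGroup (Fin N) ℂ)` WITH `hD : D.IsPrintedAveraged` (`T4ApexPrinted`), i.e. with the
averaging maps AND the gauge group pinned to [Balaban1987RG1] (0.4) (`BlockAveraging.blockAvg ExpMeanLog.expMeanLogSU`) or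
(0.10)–(0.12) on `SU(N)`.  Generations 4–6 inhabited NODE S's holonomy-level input `QLaHolonomyDefect.HolDevBound` with the
contracting rate `θ = L^{1−d}` for the ABELIAN (0.4) model (`linAvg`, file 10) and for B7's averaging (15) on `U(N)` (`avgB7`,
files 17–20) — admissible `FiniteEpsData` instances, but NOT members of the headline's class (census R45 fork (b-ii), R34).  This
file and its three sequels inhabit `BondDevBound` ∕ `HolDevBound` ∕ `LoopDefectBound` for THE PRINTED PRESCRIPTION ITSELF,
`blockAvg expMeanLogSU` on `SU(N)`, on small sup-ball domains around the flat configuration, with the printed rate `θ = L^{1−d}`.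

THE MECHANISM (generation 8).  NODE S needs only the FLAT-REFERENCE form (`V′ = 1`): every coarse bond variable of `avgⁿ V`, in a
suitable gauge, is within `Cb·θⁿ·tv(1,V)` of the identity (`BondDevBound`).  That form follows from a ONE-POINT SECOND-ORDER
expansion of the one-step map about `V = 1` — not from the two-configuration Lipschitz analysis of [Balaban1985Averaging] Props 3–5
(the row-O3c content NE1a-STEP, on which nothing is claimed here).  §1 of this file is the abstract half: a ONE-STEP framed
contraction from the flat configuration with level-dependent factors (`FlatStepContraction av dom θf`) propagates up the tower by
gauge covariance ([Balaban1985Averaging] (11), the pattern of `T4AvgDerivBound.descend`) and yields `BondDevBound av dom Cb θ`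
whenever `∏_{i<n} θf(k+i) ≤ Cb·θⁿ`.  §2–§3 are the elementary second-order estimates the one-step analysis of the sequel needs:
products of norm-`≤ 1` elements to second order, the inverse to second order, the linearisation of a parallel transport along a
walk (`‖𝒰(γ) − 1 − Lin(γ)‖ ≤ (Σ_γ dist1)²`, the group-level shadow of [Balaban1985Averaging] (31) p. 22); the printed small-loop
average `expMeanLogSU` to second order is the business of the next file `QLaBlockAvgEML`.

HONEST FRAMING.  [folklore] bookkeeping and elementary normed-ring estimates; the small-field domains of the sequel are OUR choice
(sup-balls `dist1 ≤ ρ_j` shrinking geometrically down the levels, of the KIND of [Balaban1985Averaging] (158) `|A| < α₁` on the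
`η`-lattice — census R43∕R46), not Bałaban's (52)∕(158) conditions verbatim; nothing is claimed about NE1a-STEP (two
configurations), about the two-level prescription (0.10)–(0.12), or about Bałaban's densities, R-operation or (1.100) insert.
(QL-a) NOT IN PRINT ([Balaban1989LargeFieldII] p. 356 defers observables); NE7 NOT proved; spine 0∕9; fixed finite T⁴ — NOT ℝ⁴,
NOT infinite volume, NOT a mass gap, NOT Clay.
-/

noncomputable section

open Finset
open scoped BigOperators Matrix Matrix.Norms.L2Operator

namespace Summit.QuantumFields.BalabanUV.T4Continuum.Spine.NE7

open Literature.MathematicalPhysics.QuantumFieldTheory.Balaban1983to89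
open Literature.MathematicalPhysics.QuantumFieldTheory.Balaban1983to89.T4Continuum
open Literature.MathematicalPhysics.QuantumFieldTheory.Balaban1983to89.T4AvgSensitivity
open Literature.MathematicalPhysics.QuantumFieldTheory.Balaban1983to89.T4AvgDerivBound

/-! ## §1 Framed descent from the flat configuration (any gauge group, any averaging family) -/

section Descent

variable {P : Params} {G : Type*} [GaugeGroup G]

/-- [shape] HYPOTHESIS SHAPE — ONE-STEP FRAMED CONTRACTION FROM THE FLAT CONFIGURATION with level-dependent factors (cell typing,
generation 8; the `V′ = 1` half of NE1a-STEP, which is all that NODE S consumes): for every domain configuration `V` of level `j`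
there is a gauge transformation `u` of `T^{(j+1)}` (a FRAME) such that the framed average `(avg V)^u` lies in the next domain and
`tv(1, (avg V)^u) ≤ θf(j)·tv(1, V)`.  Inhabited for the printed (0.4) prescription on `SU(N)` by the sequel
`QLaBlockAvgContraction` with `θf(j) = L^{1−d} + K₁ρ_j`, `Σ_j K₁ρ_j ≤ L^{1−d}/2`. [folklore] -/
def FlatStepContraction (av : ∀ j, Averaging P j G) (dom : ∀ j, Set (GaugeField P j G)) (θf : ℕ → ℝ) : Prop :=
  ∀ j, j + 1 ≤ P.m + P.K → ∀ V : GaugeField P j G, V ∈ dom j →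
    ∃ u : GaugeTransf P (j + 1) G, GaugeField.gaugeAct u ((av j).avg V) ∈ dom (j + 1) ∧
      tv 1 (GaugeField.gaugeAct u ((av j).avg V)) ≤ θf j * tv 1 V

/-- **FRAMED DESCENT**: under `FlatStepContraction`, after `n` steps the average of a domain configuration is gauge equivalent to
a domain configuration whose total variation from the flat configuration is at most `(∏_{i<n} θf(k+i))·tv(1,V)` — the frames are
pushed up the tower by covariance ([Balaban1985Averaging] (11), `Setup.Averaging.covariant`) and composed, as in
`T4AvgDerivBound.descend`. [cite: Balaban1985Averaging, (11) p.19] -/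
theorem framedDescent {av : ∀ j, Averaging P j G} {dom : ∀ j, Set (GaugeField P j G)} {θf : ℕ → ℝ}
    (h : FlatStepContraction av dom θf) (hθ : ∀ j, 0 ≤ θf j) {k : ℕ} :
    ∀ n : ℕ, k + n ≤ P.m + P.K → ∀ V : GaugeField P k G, V ∈ dom k →
      ∃ u : GaugeTransf P (k + n) G, GaugeField.gaugeAct u (iterFrom av k n V) ∈ dom (k + n) ∧
        tv 1 (GaugeField.gaugeAct u (iterFrom av k n V)) ≤ (∏ i ∈ range n, θf (k + i)) * tv 1 V
  | 0, _, V, hV => by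
    refine ⟨fun _ => 1, ?_, ?_⟩
    · have : GaugeField.gaugeAct (fun _ => (1 : G)) (iterFrom av k 0 V) = V := by
        funext b; simp [GaugeField.gaugeAct]
      rw [this]; exact hV
    · have : GaugeField.gaugeAct (fun _ => (1 : G)) (iterFrom av k 0 V) = V := by
        funext b; simp [GaugeField.gaugeAct]
      rw [this]; simp
  | n + 1, hn, V, hV => by
    obtain ⟨u, hu, htv⟩ := framedDescent h hθ n (by omega) V hV
    obtain ⟨u', hu', htv'⟩ := h (k + n) (by omega) _ hu
    have key : (GaugeField.gaugeAct (fun y => u' y * u (emb y)) ((av (k + n)).avg (iterFrom av k n V)) :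
          GaugeField P (k + n + 1) G)
        = GaugeField.gaugeAct u' ((av (k + n)).avg (GaugeField.gaugeAct u (iterFrom av k n V))) := by
      rw [(av (k + n)).covariant (by omega) u (iterFrom av k n V)]
      funext c
      simp only [GaugeField.gaugeAct, mul_inv_rev, mul_assoc]
    have hprod : 0 ≤ ∏ i ∈ range n, θf (k + i) := Finset.prod_nonneg fun i _ => hθ _
    refine ⟨fun y => u' y * u (emb y), ?_, ?_⟩
    · show (GaugeField.gaugeAct (fun y => u' y * u (emb y)) ((av (k + n)).avg (iterFrom av k n V)) :
          GaugeField P (k + n + 1) G) ∈ dom (k + n + 1)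
      rw [key]; exact hu'
    · show tv (1 : GaugeField P (k + n + 1) G)
          (GaugeField.gaugeAct (fun y => u' y * u (emb y)) ((av (k + n)).avg (iterFrom av k n V)))
          ≤ (∏ i ∈ range (n + 1), θf (k + i)) * tv 1 V
      rw [key, Finset.prod_range_succ]
      refine htv'.trans ?_
      calc θf (k + n) * tv 1 (GaugeField.gaugeAct u (iterFrom av k n V))
          ≤ θf (k + n) * ((∏ i ∈ range n, θf (k + i)) * tv 1 V) := mul_le_mul_of_nonneg_left htv (hθ _)
        _ = (∏ i ∈ range n, θf (k + i)) * θf (k + n) * tv 1 V := by ring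

/-- **`FlatStepContraction` ⟹ `BondDevBound`** (generation 4's per-coarse-bond shape, file 8): if the level factors compose to
`∏_{i<n} θf(k+i) ≤ Cb·θⁿ`, every coarse bond of the framed `n`-fold average is within `Cb·tv(1,V)·θⁿ` of the identity (a single
bond deviation is at most the total variation, `bdist_le_tv`). [folklore] -/
theorem bondDevBound_of_flatStepContraction {av : ∀ j, Averaging P j G} {dom : ∀ j, Set (GaugeField P j G)} {θf : ℕ → ℝ}
    (h : FlatStepContraction av dom θf) (hθ : ∀ j, 0 ≤ θf j) {Cb θ : ℝ}
    (hprod : ∀ k n : ℕ, k + n ≤ P.m + P.K → ∏ i ∈ range n, θf (k + i) ≤ Cb * θ ^ n) :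
    BondDevBound av dom Cb θ := by
  intro k n hn V hV _
  obtain ⟨u, _, htv⟩ := framedDescent h hθ n hn V hV
  refine ⟨u, fun c => ?_⟩
  calc bdist ((1 : GaugeField P (k + n) G) c) (GaugeField.gaugeAct u (iterFrom av k n V) c)
      ≤ tv 1 (GaugeField.gaugeAct u (iterFrom av k n V)) := bdist_le_tv 1 _ c
    _ ≤ (∏ i ∈ range n, θf (k + i)) * tv 1 V := htv
    _ ≤ Cb * θ ^ n * tv 1 V := mul_le_mul_of_nonneg_right (hprod k n hn) (tv_nonneg _ _)
    _ = Cb * (tv 1 V * θ ^ n) := by ring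

/-- Along any sequence of steps, the holonomy deviates from the identity by at most the sum of the deviations of the bond
variables met (`dist1` is inversion invariant and subadditive). [folklore] -/
theorem dist1_holAt_le_sum {j : ℕ} (V : GaugeField P j G) :
    ∀ γ : List (LStep P j), dist1 (holAt V γ) ≤ (γ.map fun s => dist1 (V s.bond)).sum
  | [] => by simp [holAt_nil, GaugeGroup.dist1_one]
  | s :: γ => by
    rw [holAt_cons, List.map_cons, List.sum_cons]
    refine (GaugeGroup.dist1_mul_le _ _).trans (add_le_add ?_ (dist1_holAt_le_sum V γ))
    rcases s with ⟨b, _ | _⟩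
    · simp [GaugeGroup.dist1_inv]
    · simp

end Descent

/-! ## §2 Second-order estimates in a normed ring for elements of norm at most one -/

section Ring

variable {𝔸 : Type*} [NormedRing 𝔸]

/-- THE INVERSE TO SECOND ORDER: if `gh = hg = 1` and `‖h‖ ≤ 1` then `‖(h − 1) + (g − 1)‖ ≤ ‖g − 1‖²`
(`h + g − 2 = h(1 − g)²`). [folklore] -/
theorem norm_inv_sub_one_add_le {g h : 𝔸} (hhg : h * g = 1) (hh : ‖h‖ ≤ 1) :
    ‖(h - 1) + (g - 1)‖ ≤ ‖g - 1‖ ^ 2 := by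
  have e : (h - 1) + (g - 1) = h * ((g - 1) * (g - 1)) := by
    have : h * ((g - 1) * (g - 1)) = h * g * g - 2 * (h * g) + h := by noncomm_ring
    rw [this, hhg]; noncomm_ring
  rw [e]
  calc ‖h * ((g - 1) * (g - 1))‖ ≤ ‖h‖ * ‖(g - 1) * (g - 1)‖ := norm_mul_le _ _
    _ ≤ 1 * (‖g - 1‖ * ‖g - 1‖) := by gcongr; exact norm_mul_le _ _
    _ = ‖g - 1‖ ^ 2 := by ring

/-- FOUR FACTORS TO SECOND ORDER with INDIVIDUAL first-order sizes: if `‖F₁‖, ‖F₂‖ ≤ 1`, `‖F_k − 1‖ ≤ φ_k ≤ Φ` and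
`‖F_k − 1 − t_k‖ ≤ δ_k` then `‖F₁F₂F₃F₄ − 1 − (t₁+t₂+t₃+t₄)‖ ≤ δ₁+δ₂+δ₃+δ₄ + 3Φ(φ₁+φ₂+φ₃+φ₄)` — LINEAR in the individual
sizes (the form that sums over coarse bonds to a total-variation bound), by three applications of the tree's two-factor identity
`B7Prop1Explicit.norm_mul_sub_one_sub_le` and the tree's `B8Ineq170.norm_mul_sub_one_le_of_norm_le_one`. [folklore] -/
theorem norm_prod4_sub_one_sub_le_lin {F₁ F₂ F₃ F₄ t₁ t₂ t₃ t₄ : 𝔸} {φ₁ φ₂ φ₃ φ₄ Φ δ₁ δ₂ δ₃ δ₄ : ℝ}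
    (n1 : ‖F₁‖ ≤ 1) (n2 : ‖F₂‖ ≤ 1)
    (h1 : ‖F₁ - 1‖ ≤ φ₁) (h2 : ‖F₂ - 1‖ ≤ φ₂) (h3 : ‖F₃ - 1‖ ≤ φ₃) (h4 : ‖F₄ - 1‖ ≤ φ₄)
    (b1 : φ₁ ≤ Φ) (b2 : φ₂ ≤ Φ) (b3 : φ₃ ≤ Φ) (b4 : φ₄ ≤ Φ)
    (d1 : ‖F₁ - 1 - t₁‖ ≤ δ₁) (d2 : ‖F₂ - 1 - t₂‖ ≤ δ₂) (d3 : ‖F₃ - 1 - t₃‖ ≤ δ₃) (d4 : ‖F₄ - 1 - t₄‖ ≤ δ₄) :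
    ‖F₁ * F₂ * F₃ * F₄ - 1 - (t₁ + t₂ + t₃ + t₄)‖ ≤ δ₁ + δ₂ + δ₃ + δ₄ + 3 * Φ * (φ₁ + φ₂ + φ₃ + φ₄) := by
  have p1 : 0 ≤ φ₁ := (norm_nonneg _).trans h1
  have p2 : 0 ≤ φ₂ := (norm_nonneg _).trans h2
  have p3 : 0 ≤ φ₃ := (norm_nonneg _).trans h3
  have p4 : 0 ≤ φ₄ := (norm_nonneg _).trans h4
  have n12 : ‖F₁ * F₂‖ ≤ 1 := (norm_mul_le _ _).trans (by nlinarith [norm_nonneg F₁, norm_nonneg F₂])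
  have g2 : ‖F₁ * F₂ - 1‖ ≤ φ₁ + φ₂ := (B8Ineq170.norm_mul_sub_one_le_of_norm_le_one n1).trans (add_le_add h1 h2)
  have g3 : ‖F₁ * F₂ * F₃ - 1‖ ≤ φ₁ + φ₂ + φ₃ :=
    (B8Ineq170.norm_mul_sub_one_le_of_norm_le_one n12).trans (add_le_add g2 h3)
  have m2 : ‖F₁ - 1‖ * ‖F₂ - 1‖ ≤ φ₁ * Φ := mul_le_mul h1 (h2.trans b2) (norm_nonneg _) p1
  have m3 : ‖F₁ * F₂ - 1‖ * ‖F₃ - 1‖ ≤ (φ₁ + φ₂) * Φ := mul_le_mul g2 (h3.trans b3) (norm_nonneg _) (by positivity)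
  have m4 : ‖F₁ * F₂ * F₃ - 1‖ * ‖F₄ - 1‖ ≤ (φ₁ + φ₂ + φ₃) * Φ :=
    mul_le_mul g3 (h4.trans b4) (norm_nonneg _) (by positivity)
  have e2 : ‖F₁ * F₂ - 1 - (t₁ + t₂)‖ ≤ φ₁ * Φ + δ₁ + δ₂ :=
    (B7Prop1Explicit.norm_mul_sub_one_sub_le _ _ _ _).trans (by linarith)
  have e3 : ‖F₁ * F₂ * F₃ - 1 - (t₁ + t₂ + t₃)‖ ≤ (φ₁ + φ₂) * Φ + (φ₁ * Φ + δ₁ + δ₂) + δ₃ := by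
    have := B7Prop1Explicit.norm_mul_sub_one_sub_le (F₁ * F₂) F₃ (t₁ + t₂) t₃
    rw [show t₁ + t₂ + t₃ = (t₁ + t₂) + t₃ from rfl]
    linarith
  have e4 := B7Prop1Explicit.norm_mul_sub_one_sub_le (F₁ * F₂ * F₃) F₄ (t₁ + t₂ + t₃) t₄
  rw [show t₁ + t₂ + t₃ + t₄ = (t₁ + t₂ + t₃) + t₄ from rfl]
  have hΦ : 0 ≤ Φ := p1.trans b1
  nlinarith [mul_nonneg hΦ p4, mul_nonneg hΦ p3, mul_nonneg hΦ p2]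

end Ring

/-! ## §3 The `SU(N)` toolkit: coercions, the linearised transport along a walk, the printed small-loop average to second order -/

section SUN

open ExpMeanLog MatrixLog B7Prop1Explicit

variable {n : Type*} [Fintype n] [DecidableEq n] [Nonempty n]

/-- Shorthand for the matrix algebra `M_n(ℂ)` carrying the `L²`-operator norm (B7 (19)). [folklore] -/
abbrev MatA (n : Type*) [Fintype n] [DecidableEq n] := Matrix n n ℂ

/-- In the tree's model of `SU(N)` (`UnitaryModel.instGaugeGroupSpecialUnitaryGroup`), `dist1 g = ‖g − 1‖` (operator norm).
[cite: Balaban1985Averaging, (19) p.21] -/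
theorem dist1_eq_norm (g : Matrix.specialUnitaryGroup n ℂ) : dist1 g = ‖(g : MatA n) - 1‖ := rfl

omit [Nonempty n] in
/-- The underlying matrix of an element of `SU(N)` is unitary. [folklore] -/
theorem coe_mem_unitaryGroup (g : Matrix.specialUnitaryGroup n ℂ) : (g : MatA n) ∈ Matrix.unitaryGroup n ℂ :=
  (Matrix.mem_specialUnitaryGroup_iff.1 g.2).1

/-- The underlying matrix of an element of `SU(N)` has operator norm `1`. [folklore] -/
theorem norm_coe_eq_one (g : Matrix.specialUnitaryGroup n ℂ) : ‖(g : MatA n)‖ = 1 :=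
  UnitaryModel.norm_of_mem_unitaryGroup (coe_mem_unitaryGroup g)

omit [Nonempty n] in
/-- `g⁻¹ g = 1` as matrices. [folklore] -/
theorem coe_inv_mul (g : Matrix.specialUnitaryGroup n ℂ) : ((g⁻¹ : Matrix.specialUnitaryGroup n ℂ) : MatA n) * (g : MatA n) = 1 := by
  rw [← Submonoid.coe_mul, inv_mul_cancel]; rfl

/-- `‖g⁻¹ − 1‖ = ‖g − 1‖` in `SU(N)` (`dist1` is inversion invariant). [folklore] -/
theorem norm_coe_inv_sub_one (g : Matrix.specialUnitaryGroup n ℂ) :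
    ‖((g⁻¹ : Matrix.specialUnitaryGroup n ℂ) : MatA n) - 1‖ = ‖(g : MatA n) - 1‖ := by
  rw [← dist1_eq_norm, ← dist1_eq_norm, GaugeGroup.dist1_inv]

/-- THE INVERSE TO SECOND ORDER in `SU(N)`: `‖(g⁻¹ − 1) + (g − 1)‖ ≤ ‖g − 1‖²`. [folklore] -/
theorem norm_coe_inv_sub_one_add_le (g : Matrix.specialUnitaryGroup n ℂ) :
    ‖(((g⁻¹ : Matrix.specialUnitaryGroup n ℂ) : MatA n) - 1) + ((g : MatA n) - 1)‖ ≤ ‖(g : MatA n) - 1‖ ^ 2 :=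
  norm_inv_sub_one_add_le (coe_inv_mul g) (le_of_eq (norm_coe_eq_one g⁻¹))

variable {P : Params} {j : ℕ}

/-- THE LINEARISED STEP: `+(V_b − 1)` for a forward step, `−(V_b − 1)` for a backward one (the first-order term of `V_b^{±1} − 1`,
as in the linear averaging operation (14) of [Balaban1985Averaging] p. 19, by which «we demand that (1/i) log Ū is well approximated»).
[cite: Balaban1985Averaging, (14) p.19] -/
def stepLin (V : GaugeField P j (Matrix.specialUnitaryGroup n ℂ)) (s : LStep P j) : MatA n :=
  if s.fwd then ((V s.bond : Matrix.specialUnitaryGroup n ℂ) : MatA n) - 1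
  else 1 - ((V s.bond : Matrix.specialUnitaryGroup n ℂ) : MatA n)

/-- THE LINEARISED TRANSPORT along a sequence of steps: the sum of the linearised steps (B7 (14) `A(Γ)`). [cite: Balaban1985Averaging, (14) p.19] -/
def walkLin (V : GaugeField P j (Matrix.specialUnitaryGroup n ℂ)) (γ : List (LStep P j)) : MatA n := (γ.map (stepLin V)).sum

/-- THE MASS met along a sequence of steps: the sum of the deviations `dist1 V_b` of the bond variables traversed. [folklore] -/
def walkMass (V : GaugeField P j (Matrix.specialUnitaryGroup n ℂ)) (γ : List (LStep P j)) : ℝ :=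
  (γ.map fun s => dist1 (V s.bond)).sum

omit [Nonempty n] in
/-- `walkLin` of a concatenation. [folklore] -/
@[simp] theorem walkLin_append (V : GaugeField P j (Matrix.specialUnitaryGroup n ℂ)) (γ₁ γ₂ : List (LStep P j)) :
    walkLin V (γ₁ ++ γ₂) = walkLin V γ₁ + walkLin V γ₂ := by
  simp [walkLin, List.map_append, List.sum_append]

omit [Nonempty n] in
/-- `walkLin` of a cons. [folklore] -/
@[simp] theorem walkLin_cons (V : GaugeField P j (Matrix.specialUnitaryGroup n ℂ)) (s : LStep P j) (γ : List (LStep P j)) :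
    walkLin V (s :: γ) = stepLin V s + walkLin V γ := by
  simp [walkLin]

omit [Nonempty n] in
/-- `walkLin` of the empty walk. [folklore] -/
@[simp] theorem walkLin_nil (V : GaugeField P j (Matrix.specialUnitaryGroup n ℂ)) : walkLin V [] = 0 := by
  simp [walkLin]

/-- `walkMass` of a concatenation. [folklore] -/
@[simp] theorem walkMass_append (V : GaugeField P j (Matrix.specialUnitaryGroup n ℂ)) (γ₁ γ₂ : List (LStep P j)) :
    walkMass V (γ₁ ++ γ₂) = walkMass V γ₁ + walkMass V γ₂ := by
  simp [walkMass, List.map_append, List.sum_append]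

/-- `walkMass` of a cons. [folklore] -/
@[simp] theorem walkMass_cons (V : GaugeField P j (Matrix.specialUnitaryGroup n ℂ)) (s : LStep P j) (γ : List (LStep P j)) :
    walkMass V (s :: γ) = dist1 (V s.bond) + walkMass V γ := by
  simp [walkMass]

/-- `walkMass` of the empty walk. [folklore] -/
@[simp] theorem walkMass_nil (V : GaugeField P j (Matrix.specialUnitaryGroup n ℂ)) : walkMass V [] = 0 := by
  simp [walkMass]

/-- Masses are non-negative. [folklore] -/
theorem walkMass_nonneg (V : GaugeField P j (Matrix.specialUnitaryGroup n ℂ)) (γ : List (LStep P j)) : 0 ≤ walkMass V γ := by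
  unfold walkMass
  exact List.sum_nonneg (by
    intro x hx
    obtain ⟨s, _, rfl⟩ := List.mem_map.mp hx
    exact GaugeGroup.dist1_nonneg _)

/-- A linearised step has the size of the bond deviation. [folklore] -/
theorem norm_stepLin (V : GaugeField P j (Matrix.specialUnitaryGroup n ℂ)) (s : LStep P j) :
    ‖stepLin V s‖ = dist1 (V s.bond) := by
  unfold stepLin
  split_ifs
  · rw [dist1_eq_norm]
  · rw [dist1_eq_norm, ← norm_neg, neg_sub]

/-- The linearised transport is bounded by the mass. [folklore] -/
theorem norm_walkLin_le (V : GaugeField P j (Matrix.specialUnitaryGroup n ℂ)) :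
    ∀ γ : List (LStep P j), ‖walkLin V γ‖ ≤ walkMass V γ
  | [] => by simp
  | s :: γ => by
    rw [walkLin_cons, walkMass_cons]
    exact (norm_add_le _ _).trans (add_le_add (le_of_eq (norm_stepLin V s)) (norm_walkLin_le V γ))

/-- The transport deviates from the identity by at most the mass. [folklore] -/
theorem dist1_holAt_le_walkMass (V : GaugeField P j (Matrix.specialUnitaryGroup n ℂ)) (γ : List (LStep P j)) :
    dist1 (holAt V γ) ≤ walkMass V γ :=
  dist1_holAt_le_sum V γ

/-- One step to second order: `‖(V_b^{±1} − 1) − stepLin‖ ≤ dist1(V_b)²` (zero for a forward step; the inverse lemma for a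
backward one). [folklore] -/
theorem norm_step_sub_one_sub_stepLin_le (V : GaugeField P j (Matrix.specialUnitaryGroup n ℂ)) (s : LStep P j) :
    ‖(((if s.fwd then V s.bond else (V s.bond)⁻¹ : Matrix.specialUnitaryGroup n ℂ)) : MatA n) - 1 - stepLin V s‖
      ≤ dist1 (V s.bond) ^ 2 := by
  unfold stepLin
  rcases s with ⟨b, _ | _⟩
  · simp only [Bool.false_eq_true, ↓reduceIte]
    rw [show (((V b)⁻¹ : Matrix.specialUnitaryGroup n ℂ) : MatA n) - 1 - (1 - ((V b : Matrix.specialUnitaryGroup n ℂ) : MatA n))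
        = ((((V b)⁻¹ : Matrix.specialUnitaryGroup n ℂ) : MatA n) - 1) + (((V b : Matrix.specialUnitaryGroup n ℂ) : MatA n) - 1)
        by abel, dist1_eq_norm]
    exact norm_coe_inv_sub_one_add_le (V b)
  · simp only [↓reduceIte, sub_self, norm_zero]
    positivity

/-- **THE TRANSPORT TO SECOND ORDER**: `‖𝒰_γ(V) − 1 − Lin_γ(V)‖ ≤ (walkMass V γ)²` — along the ordered product each new factor
contributes its own second-order defect plus the cross term `(factor − 1)(tail − 1)` (products to first order are sums:
the group-level shadow of [Balaban1985Averaging] (31) p. 22 `|Z − X − Y| ≤ 2|X||Y|`, `Z = log e^X e^Y`). [cite: Balaban1985Averaging, (31) p.22] -/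
theorem norm_hol_sub_one_sub_walkLin_le (V : GaugeField P j (Matrix.specialUnitaryGroup n ℂ)) :
    ∀ γ : List (LStep P j), ‖((holAt V γ : Matrix.specialUnitaryGroup n ℂ) : MatA n) - 1 - walkLin V γ‖ ≤ walkMass V γ ^ 2
  | [] => by simp [holAt]
  | s :: γ => by
    rw [holAt_cons, walkLin_cons, walkMass_cons, Submonoid.coe_mul]
    set e : MatA n := (((if s.fwd then V s.bond else (V s.bond)⁻¹ : Matrix.specialUnitaryGroup n ℂ)) : MatA n) with he
    set h : MatA n := ((holAt V γ : Matrix.specialUnitaryGroup n ℂ) : MatA n) with hh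
    have hdec : e * h - 1 - (stepLin V s + walkLin V γ)
        = (e - 1 - stepLin V s) + (h - 1 - walkLin V γ) + (e - 1) * (h - 1) := by noncomm_ring
    have he1 : ‖e - 1‖ = dist1 (V s.bond) := by
      rw [he]; rcases s with ⟨b, _ | _⟩
      · simp only [Bool.false_eq_true, ↓reduceIte]; rw [norm_coe_inv_sub_one, dist1_eq_norm]
      · simp only [↓reduceIte]; rw [dist1_eq_norm]
    have hh1 : ‖h - 1‖ ≤ walkMass V γ := by rw [hh, ← dist1_eq_norm]; exact dist1_holAt_le_walkMass V γ
    have hm := walkMass_nonneg V γ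
    have hd := GaugeGroup.dist1_nonneg (V s.bond)
    rw [hdec]
    calc ‖(e - 1 - stepLin V s) + (h - 1 - walkLin V γ) + (e - 1) * (h - 1)‖
        ≤ ‖e - 1 - stepLin V s‖ + ‖h - 1 - walkLin V γ‖ + ‖(e - 1) * (h - 1)‖ :=
          norm_add₃_le
      _ ≤ dist1 (V s.bond) ^ 2 + walkMass V γ ^ 2 + dist1 (V s.bond) * walkMass V γ := by
          refine add_le_add (add_le_add (norm_step_sub_one_sub_stepLin_le V s) (norm_hol_sub_one_sub_walkLin_le V γ)) ?_
          refine (norm_mul_le _ _).trans ?_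
          rw [he1]
          exact mul_le_mul_of_nonneg_left hh1 hd
      _ ≤ (dist1 (V s.bond) + walkMass V γ) ^ 2 := by nlinarith [mul_nonneg hd hm]

end SUN

end Summit.QuantumFields.BalabanUV.T4Continuum.Spine.NE7

end
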